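import Summits.ResolutionOfSingularities.ResolutionOfSingularities.Theorems.WeightedInvariantIota3TauDescentExtReesMap
import Summits.ResolutionOfSingularities.ResolutionOfSingularities.Theorems.WeightedInvariantIota3TauDescentBaseTwoAssembly
import Summits.ResolutionOfSingularities.ResolutionOfSingularities.Theorems.WeightedInvariantWeightedConstructionWeightedChartBasicOpen
import Mathlib.RingTheory.TensorProduct.MonoidAlgebra
import HarnessLib

/-!
# The extended Rees algebra of a weighted filtration commutes with FLAT BASE CHANGE: `T' ⊗_T T[t⁻¹, 𝒥ₙ tⁿ] ≅ T'[t⁻¹, (𝒥ₙ T') tⁿ]`; hence along a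
# local, formally smooth, essentially-of-finite-type `φ : T → T'` the coefficientwise map of extended Rees algebras REFLECTS ORDERS at primes —
# and (desc-τ) case A′ holds in the door setting (door `HypersurfaceCentreConstruction`, stmt-ResolutionOfSingularities-19897; gap (1) (desc-τ))

Topic: `Summits/ResolutionOfSingularities/ResolutionOfSingularities/Theorems`. Helper for the door item `HypersurfaceCentreConstruction`
(stmt-ResolutionOfSingularities-19897, route `WeightedInvariant`), line `local-engine`, def-free.  This file supplies the last brick `hbc` of
…Iota3TauDescentBaseTwoAssembly (`Iota3.not_isTiePosition_map_of_baseChange`):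

* `ExtReesMap.baseChange_mem` / `baseChange_surjective` / `injective_baseChange` — for `T → T'` FLAT and `𝒥` any filtration of `T`, the `T'`-algebra map
  `T' ⊗_T T[t⁻¹, 𝒥ₙ tⁿ] → T'[t, t⁻¹]` (Mathlib `AddMonoidAlgebra.scalarTensorEquiv` ∘ `id ⊗ incl`) is injective with image
  `T'[t⁻¹, (𝒥ₙ T') tⁿ]`; so the coefficientwise map `ψ` of …ExtReesMap is a flat base change.
* `ExtReesMap.adicOrder_localization_eq_of_formallySmooth` (orders along any formally smooth essentially-of-finite-type algebra of Noetherian rings, prime by prime), `ExtReesMap.formallySmooth_of_coe` (the coefficientwise `ψ` IS the base change `B ⊗_T T' ≅ B'`), **`ExtReesMap.adicOrder_eq_of_formallySmooth`** — along `φ : T → T'` formally smooth and essentially of finite type (Noetherian rings), for a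
  weighted filtration `𝒥 = 𝒥(u; w)` and `𝒥ₙ' = 𝒥ₙ T'`: `ψ : B = T[t⁻¹, 𝒥ₙ tⁿ] → B' = T'[t⁻¹, 𝒥ₙ' tⁿ]` is formally smooth and essentially of
  finite type (`B' ≅ B ⊗_T T'`), so at every prime `𝔫` of `B'` the localised map `B_{ψ⁻¹𝔫} → B'_𝔫` preserves `adicOrder`
  (`IotaOrderEssSmooth.adicOrder_algebraMap_eq_of_formallySmooth`).
* **`ExtReesMap.exists_baseChange`** — the hypothesis `hbc` of `Iota3.not_isTiePosition_map_of_baseChange`, DISCHARGED.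
* **`Iota3.not_isTiePosition_map_of_ringKrullDim_eq_two`** — (desc-τ) CASE A′ IN THE DOOR SETTING, UNCONDITIONAL: over a two-dimensional regular
  local base essentially of finite type over a field, no local formally smooth essentially-of-finite-type `φ : T → T'` into a regular `T'` carries
  `g ∈ T` to a tie position.

[OURS · L1 W4.3 · (desc-τ) case A′, base-change brick (4) + conclusion]  Replaces the role of NO printed item; NOT a statement of the manuscript under
review [claim: Hironaka2017, status: under-review]; candidates stay candidates; AI work, weaker than expert review.  No definition; no axiom.

## References

* J. Włodarczyk, *Functorial resolution by torus actions*, arXiv:2203.03090, Def. 2.3.5, App. Def. 5.1.1 (`B = Spec_X 𝒪_X[t⁻¹, 𝒥 t]` is a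
  relative spectrum, compatible with flat base change). [Wlodarczyk2022]
* H. Matsumura, *Commutative Ring Theory* (1986), §22 Cor. to Thm. 22.5 (orders along flat local maps with regular fibre). [Matsumura1987]
* D. Abramovich, M. H. Quek, B. Schober, arXiv:2507.01232 (2025), Thm 1.3 (3). [AbramovichQuekSchober2025]
-/

noncomputable section

set_option linter.dupNamespace false -- mandated namespace `Summit.<Summit>.<Problem>` of this single-conjunct summit

open scoped LaurentPolynomial TensorProduct
open LaurentPolynomial Literature.AlgebraicGeometry.Resolution IsLocalRing
open Summit.ResolutionOfSingularities.ResolutionOfSingularities.Theorems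

namespace Summit.ResolutionOfSingularities.ResolutionOfSingularities.Cruxes.HypersurfaceCentreConstruction.LocalEngine

namespace ExtReesMap

section Flat

variable (A A' : Type) [CommRing A] [CommRing A'] [Algebra A A'] (I : ℕ → Ideal A)

/-- The image of a pure tensor `a ⊗ b` under `A' ⊗_A B → A' ⊗_A A[t,t⁻¹] ≅ A'[t,t⁻¹]` is `a · (coefficientwise φ)(b)`. [folklore] -/
theorem baseChange_tmul (a : A') (b : extReesAlgebra I) :
    ((AddMonoidAlgebra.scalarTensorEquiv A A' (M := ℤ)).toAlgHom.comp
        (Algebra.TensorProduct.map (AlgHom.id A' A') (extReesAlgebra I).val)) (a ⊗ₜ b) =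
      C a * AddMonoidAlgebra.mapRingHom ℤ (algebraMap A A') (b : A[T;T⁻¹]) := by
  rw [AlgHom.comp_apply, Algebra.TensorProduct.map_tmul, AlgHom.id_apply, Subalgebra.val_apply]
  change AddMonoidAlgebra.scalarTensorEquiv A A' (a ⊗ₜ (b : A[T;T⁻¹])) = _
  rw [AddMonoidAlgebra.scalarTensorEquiv_tmul, Algebra.smul_def, C_eq_algebraMap]
  rfl

/-- **The base-change map lands in `A'[t⁻¹, (𝒥ₙ A') tⁿ]`.** [cite: Wlodarczyk2022, App. Def. 5.1.1] -/
theorem baseChange_mem (z : A' ⊗[A] extReesAlgebra I) :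
    ((AddMonoidAlgebra.scalarTensorEquiv A A' (M := ℤ)).toAlgHom.comp
        (Algebra.TensorProduct.map (AlgHom.id A' A') (extReesAlgebra I).val)) z ∈
      extReesAlgebra (fun n => (I n).map (algebraMap A A')) := by
  have hle : ∀ n, (I n).map (algebraMap A A') ≤ (fun n => (I n).map (algebraMap A A')) n := fun n => le_rfl
  induction z using TensorProduct.induction_on with
  | zero => rw [map_zero]; exact zero_mem _
  | tmul a b =>
    rw [baseChange_tmul]
    refine mul_mem ?_ (mapRingHom_mem (algebraMap A A') I _ hle b.2)
    rw [C_eq_algebraMap]; exact Subalgebra.algebraMap_mem _ a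
  | add x y hx hy => rw [map_add]; exact add_mem hx hy

/-- **… and hits all of it.** [cite: Wlodarczyk2022, App. Def. 5.1.1] -/
theorem baseChange_surjective {x : A'[T;T⁻¹]} (hx : x ∈ extReesAlgebra (fun n => (I n).map (algebraMap A A'))) :
    ∃ z : A' ⊗[A] extReesAlgebra I,
      ((AddMonoidAlgebra.scalarTensorEquiv A A' (M := ℤ)).toAlgHom.comp
        (Algebra.TensorProduct.map (AlgHom.id A' A') (extReesAlgebra I).val)) z = x := by
  set χ := (AddMonoidAlgebra.scalarTensorEquiv A A' (M := ℤ)).toAlgHom.comp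
        (Algebra.TensorProduct.map (AlgHom.id A' A') (extReesAlgebra I).val) with hχ
  suffices h : extReesAlgebra (fun n => (I n).map (algebraMap A A')) ≤ χ.range by
    have hx' := h hx
    rwa [AlgHom.mem_range] at hx'
  change Algebra.adjoin A' _ ≤ χ.range
  refine Algebra.adjoin_le ?_
  rw [AlgHom.coe_range]
  rintro x hx
  rcases hx with rfl | ⟨n, hn, a', ha', rfl⟩
  · refine ⟨(1 : A') ⊗ₜ extReesAlgebra.tInv I, ?_⟩
    rw [hχ, baseChange_tmul, extReesAlgebra.coe_tInv, mapRingHom_T, map_one, one_mul]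
  · -- `a' ∈ 𝒥ₙ A' = span (φ '' 𝒥ₙ)`
    refine Submodule.span_induction (p := fun a'' _ => C a'' * T (n : ℤ) ∈ Set.range χ) ?_ ?_ ?_ ?_ ha'
    · rintro _ ⟨a, ha, rfl⟩
      refine ⟨(1 : A') ⊗ₜ ⟨C a * T (n : ℤ), extReesAlgebra.C_mul_T_mem I hn ha⟩, ?_⟩
      rw [hχ, baseChange_tmul, map_one, one_mul]
      change AddMonoidAlgebra.mapRingHom ℤ (algebraMap A A') (C a * T (n : ℤ)) = _
      rw [map_mul, mapRingHom_C, mapRingHom_T]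
    · refine ⟨0, ?_⟩
      rw [map_zero, map_zero, zero_mul]
    · rintro a₁ a₂ - - ⟨z₁, h₁⟩ ⟨z₂, h₂⟩
      refine ⟨z₁ + z₂, ?_⟩
      rw [map_add, h₁, h₂, map_add, add_mul]
    · rintro c a₁ - ⟨z₁, h₁⟩
      refine ⟨(c ⊗ₜ (1 : extReesAlgebra I)) * z₁, ?_⟩
      rw [map_mul, h₁, hχ, baseChange_tmul, Subalgebra.coe_one, map_one, mul_one, smul_eq_mul, map_mul, mul_assoc]

/-- **The base-change map is injective when `A'` is flat over `A`** (`id ⊗ incl` tensored with a flat module, then an isomorphism).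
[cite: Matsumura1987, Thm. 7.5] -/
theorem injective_baseChange [Module.Flat A A'] :
    Function.Injective ((AddMonoidAlgebra.scalarTensorEquiv A A' (M := ℤ)).toAlgHom.comp
        (Algebra.TensorProduct.map (AlgHom.id A' A') (extReesAlgebra I).val)) := by
  rw [AlgHom.coe_comp]
  refine (AlgEquiv.injective _).comp ?_
  have h := Module.Flat.lTensor_preserves_injective_linearMap (M := A') (extReesAlgebra I).val.toLinearMap
    Subtype.val_injective
  intro x y hxy
  apply h
  have hfun : ∀ z, (Algebra.TensorProduct.map (AlgHom.id A' A') (extReesAlgebra I).val) z =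
      LinearMap.lTensor A' (extReesAlgebra I).val.toLinearMap z := by
    intro z
    induction z using TensorProduct.induction_on with
    | zero => rw [map_zero, map_zero]
    | tmul a b => rw [Algebra.TensorProduct.map_tmul, LinearMap.lTensor_tmul]; rfl
    | add x y hx hy => rw [map_add, map_add, hx, hy]
  rw [← hfun, ← hfun]; exact hxy

end Flat

/-! ## Order reflection along the coefficientwise map -/

section Smooth

/-- `A[t⁻¹, 𝒥ₙ(u; w) tⁿ]` is Noetherian (it is Włodarczyk's `A[t⁻¹, uᵢ t^{wᵢ}]`, a quotient of a polynomial ring). [folklore] -/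
theorem isNoetherianRing_extReesAlgebra (A : Type) [CommRing A] [IsNoetherianRing A] {m : ℕ} (u : Fin m → A) (w : Fin m → ℕ) :
    IsNoetherianRing (extReesAlgebra (weightedMonomialIdeal u w)) := by
  rw [extReesAlgebra_weightedMonomialIdeal_eq_cobordantAlgebra]
  exact cobordantAlgebra.isNoetherianRing u w

/-- `A[t⁻¹, 𝒥ₙ(u; w) tⁿ]` is of finite type over `A`. [folklore] -/
theorem finiteType_extReesAlgebra (A : Type) [CommRing A] {m : ℕ} (u : Fin m → A) (w : Fin m → ℕ) :
    Algebra.FiniteType A (extReesAlgebra (weightedMonomialIdeal u w)) := by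
  rw [extReesAlgebra_weightedMonomialIdeal_eq_cobordantAlgebra]
  exact Algebra.FiniteType.of_surjective (cobordantAlgebra.presentation u w) (cobordantAlgebra.presentation_surjective u w)

variable (R R' : Type) [CommRing R] [CommRing R'] [IsNoetherianRing R] [IsNoetherianRing R'] [Algebra R R']
  [Algebra.FormallySmooth R R'] [Algebra.EssFiniteType R R'] [Module.Flat R R'] {m : ℕ} (u : Fin m → R) (w : Fin m → ℕ)

/-- **Orders along a formally smooth, essentially-of-finite-type algebra, prime by prime**: for `B → B'` formally smooth and essentially of finite
type between Noetherian rings and a prime `𝔫` of `B'`, the localised homomorphism `B_{𝔫 ∩ B} → B'_𝔫` (local, flat, regular closed fibre) preserves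
`adicOrder`. [cite: Matsumura1987, §22 Cor. to Thm. 22.5] -/
theorem adicOrder_localization_eq_of_formallySmooth (B B' : Type) [CommRing B] [CommRing B'] [IsNoetherianRing B] [IsNoetherianRing B']
    [Algebra B B'] [Algebra.FormallySmooth B B'] [Algebra.EssFiniteType B B'] (𝔫 : Ideal B') [𝔫.IsPrime] (b : B) :
    adicOrder (algebraMap B' (Localization.AtPrime 𝔫) (algebraMap B B' b)) =
      adicOrder (algebraMap B (Localization.AtPrime (𝔫.comap (algebraMap B B'))) b) := by
  set O := Localization.AtPrime (𝔫.comap (algebraMap B B')) with hO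
  set L := Localization.AtPrime 𝔫 with hL
  letI : Algebra O L := (Localization.localRingHom (𝔫.comap (algebraMap B B')) 𝔫 (algebraMap B B') rfl).toAlgebra
  haveI : IsScalarTower B O L := IsScalarTower.of_algebraMap_eq fun s => by
    change _ = Localization.localRingHom (𝔫.comap (algebraMap B B')) 𝔫 (algebraMap B B') rfl (algebraMap B O s)
    rw [Localization.localRingHom_to_map, IsScalarTower.algebraMap_apply B B' L]
  haveI : IsLocalHom (algebraMap O L) := Localization.isLocalHom_localRingHom (𝔫.comap (algebraMap B B')) 𝔫 (algebraMap B B') rfl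
  haveI : Algebra.FormallySmooth B L := Algebra.FormallySmooth.comp B B' L
  haveI : Algebra.EssFiniteType B L := Algebra.EssFiniteType.comp B B' L
  haveI : Algebra.FormallySmooth O L := Algebra.FormallySmooth.localization_base (𝔫.comap (algebraMap B B')).primeCompl
  haveI : Algebra.EssFiniteType O L := Algebra.EssFiniteType.of_comp B O L
  have key := IotaOrderEssSmooth.adicOrder_algebraMap_eq_of_formallySmooth O L (algebraMap B O b)
  have hmap : algebraMap O L (algebraMap B O b) = algebraMap B' L (algebraMap B B' b) := by
    rw [← IsScalarTower.algebraMap_apply B O L b, IsScalarTower.algebraMap_apply B B' L b]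
  rw [hmap] at key
  exact key

omit [IsNoetherianRing R] [IsNoetherianRing R'] in
/-- **THE COEFFICIENTWISE MAP IS A FLAT BASE CHANGE**: `φ : R → R'` flat, `𝒥 = 𝒥(u; w)`, `𝒥ₙ' = 𝒥ₙ R'`, `ψ : B → B'` the coefficientwise map;
then `B ⊗_R R' ≅ B'` as `B`-algebras (for the algebra structure `ψ`), so `ψ` is formally smooth and essentially of finite type when `φ` is.
[cite: Wlodarczyk2022, App. Def. 5.1.1] -/
theorem formallySmooth_of_coe
    (ψ : extReesAlgebra (weightedMonomialIdeal u w) →+* extReesAlgebra (fun n => (weightedMonomialIdeal u w n).map (algebraMap R R')))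
    (hψ : ∀ b, ((ψ b : extReesAlgebra (fun n => (weightedMonomialIdeal u w n).map (algebraMap R R'))) : R'[T;T⁻¹]) =
      AddMonoidAlgebra.mapRingHom ℤ (algebraMap R R') (b : R[T;T⁻¹])) :
    @Algebra.FormallySmooth (extReesAlgebra (weightedMonomialIdeal u w))
        (extReesAlgebra (fun n => (weightedMonomialIdeal u w n).map (algebraMap R R'))) _ _ ψ.toAlgebra ∧
      @Algebra.EssFiniteType (extReesAlgebra (weightedMonomialIdeal u w))
        (extReesAlgebra (fun n => (weightedMonomialIdeal u w n).map (algebraMap R R'))) _ _ ψ.toAlgebra := by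
  classical
  -- the base-change isomorphism `R' ⊗_R B ≃ B'`
  let χ := (AddMonoidAlgebra.scalarTensorEquiv R R' (M := ℤ)).toAlgHom.comp
        (Algebra.TensorProduct.map (AlgHom.id R' R') (extReesAlgebra (weightedMonomialIdeal u w)).val)
  have hχ : χ = (AddMonoidAlgebra.scalarTensorEquiv R R' (M := ℤ)).toAlgHom.comp
        (Algebra.TensorProduct.map (AlgHom.id R' R') (extReesAlgebra (weightedMonomialIdeal u w)).val) := rfl
  have hmem : ∀ z, χ z ∈ extReesAlgebra (fun n => (weightedMonomialIdeal u w n).map (algebraMap R R')) :=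
    fun z => baseChange_mem R R' (weightedMonomialIdeal u w) z
  have hinj : Function.Injective (χ.codRestrict (extReesAlgebra (fun n => (weightedMonomialIdeal u w n).map (algebraMap R R'))) hmem) := by
    intro x y hxy
    exact injective_baseChange R R' _ (congrArg Subtype.val hxy)
  have hsurj : Function.Surjective (χ.codRestrict (extReesAlgebra (fun n => (weightedMonomialIdeal u w n).map (algebraMap R R'))) hmem) := by
    rintro ⟨z, hz⟩
    obtain ⟨x, hx⟩ := baseChange_surjective R R' (weightedMonomialIdeal u w) hz
    exact ⟨x, Subtype.ext hx⟩
  let ρ : R' ⊗[R] extReesAlgebra (weightedMonomialIdeal u w) ≃ₐ[R']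
      extReesAlgebra (fun n => (weightedMonomialIdeal u w n).map (algebraMap R R')) :=
    AlgEquiv.ofBijective (χ.codRestrict _ hmem) ⟨hinj, hsurj⟩
  have hρ_tmul : ∀ b : extReesAlgebra (weightedMonomialIdeal u w), ρ ((1 : R') ⊗ₜ b) = ψ b := fun b => by
    apply Subtype.ext
    rw [hψ]
    change χ ((1 : R') ⊗ₜ b) = _
    rw [hχ, baseChange_tmul, map_one, one_mul]
  -- the `B`-algebra structure `ψ` on `B'` is the base change `B ⊗_R R' ≅ B'`
  letI : Algebra (extReesAlgebra (weightedMonomialIdeal u w)) (extReesAlgebra (fun n => (weightedMonomialIdeal u w n).map (algebraMap R R'))) :=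
    ψ.toAlgebra
  have halg : ∀ b, algebraMap (extReesAlgebra (weightedMonomialIdeal u w))
      (extReesAlgebra (fun n => (weightedMonomialIdeal u w n).map (algebraMap R R'))) b = ψ b := fun _ => rfl
  let ρ' : extReesAlgebra (weightedMonomialIdeal u w) ⊗[R] R' ≃+* extReesAlgebra (fun n => (weightedMonomialIdeal u w n).map (algebraMap R R')) :=
    (Algebra.TensorProduct.comm R (extReesAlgebra (weightedMonomialIdeal u w)) R').toRingEquiv.trans ρ.toRingEquiv
  have hρ' : ∀ b : extReesAlgebra (weightedMonomialIdeal u w),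
      ρ' (algebraMap (extReesAlgebra (weightedMonomialIdeal u w)) (extReesAlgebra (weightedMonomialIdeal u w) ⊗[R] R') b) =
        algebraMap _ (extReesAlgebra (fun n => (weightedMonomialIdeal u w n).map (algebraMap R R'))) b := fun b => by
    rw [halg, Algebra.TensorProduct.algebraMap_apply, Algebra.algebraMap_self, RingHom.id_apply, ← hρ_tmul]
    change ρ ((Algebra.TensorProduct.comm R (extReesAlgebra (weightedMonomialIdeal u w)) R') (b ⊗ₜ 1)) = _
    rw [Algebra.TensorProduct.comm_tmul]
  let e : extReesAlgebra (weightedMonomialIdeal u w) ⊗[R] R' ≃ₐ[extReesAlgebra (weightedMonomialIdeal u w)]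
      extReesAlgebra (fun n => (weightedMonomialIdeal u w n).map (algebraMap R R')) := AlgEquiv.ofRingEquiv (f := ρ') hρ'
  haveI hfs : Algebra.FormallySmooth (extReesAlgebra (weightedMonomialIdeal u w))
      (extReesAlgebra (weightedMonomialIdeal u w) ⊗[R] R') := inferInstance
  exact ⟨Algebra.FormallySmooth.of_equiv (A := extReesAlgebra (weightedMonomialIdeal u w) ⊗[R] R') e,
    Algebra.EssFiniteType.of_surjective (S := extReesAlgebra (weightedMonomialIdeal u w) ⊗[R] R') e.toAlgHom
      (by intro z; obtain ⟨y, hy⟩ := e.surjective z; exact ⟨y, hy⟩)⟩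

/-- **ORDER REFLECTION ALONG THE COEFFICIENTWISE MAP.**  `φ : R → R'` flat, formally smooth and essentially of finite type between Noetherian
rings, `𝒥 = 𝒥(u; w)` a weighted filtration of `R`, `𝒥ₙ' = 𝒥ₙ R'`, and `ψ : B → B'` the coefficientwise map of …ExtReesMap.  Then at every prime
`𝔫` of `B'` the localised map `B_{ψ⁻¹𝔫} → B'_𝔫` preserves the order: `adicOrder (ψ b)_𝔫 = adicOrder b_{ψ⁻¹ 𝔫}`.
[cite: Matsumura1987, §22 Cor. to Thm. 22.5] -/
theorem adicOrder_eq_of_formallySmooth (I' : ℕ → Ideal R') (heq : ∀ n, I' n = (weightedMonomialIdeal u w n).map (algebraMap R R'))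
    (ψ : extReesAlgebra (weightedMonomialIdeal u w) →+* extReesAlgebra I')
    (hψ : ∀ b, ((ψ b : extReesAlgebra I') : R'[T;T⁻¹]) = AddMonoidAlgebra.mapRingHom ℤ (algebraMap R R') (b : R[T;T⁻¹]))
    (𝔫 : Ideal (extReesAlgebra I')) [𝔫.IsPrime] (b : extReesAlgebra (weightedMonomialIdeal u w)) :
    adicOrder (algebraMap (extReesAlgebra I') (Localization.AtPrime 𝔫) (ψ b)) =
      adicOrder (algebraMap (extReesAlgebra (weightedMonomialIdeal u w)) (Localization.AtPrime (𝔫.comap ψ)) b) := by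
  classical
  obtain rfl : I' = fun n => (weightedMonomialIdeal u w n).map (algebraMap R R') := funext heq
  haveI : IsNoetherianRing (extReesAlgebra (weightedMonomialIdeal u w)) := isNoetherianRing_extReesAlgebra R u w
  have hI'w : (fun n => (weightedMonomialIdeal u w n).map (algebraMap R R')) = weightedMonomialIdeal (fun i => algebraMap R R' (u i)) w :=
    funext fun n => weightedMonomialIdeal_map (algebraMap R R') u w n
  haveI : IsNoetherianRing (extReesAlgebra (fun n => (weightedMonomialIdeal u w n).map (algebraMap R R'))) := by
    rw [hI'w]; exact isNoetherianRing_extReesAlgebra R' _ w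
  letI : Algebra (extReesAlgebra (weightedMonomialIdeal u w)) (extReesAlgebra (fun n => (weightedMonomialIdeal u w n).map (algebraMap R R'))) :=
    ψ.toAlgebra
  obtain ⟨hfs, heft⟩ := formallySmooth_of_coe R R' u w ψ hψ
  exact adicOrder_localization_eq_of_formallySmooth _ _ 𝔫 b

/-- **THE BASE-CHANGE BRICK `hbc` OF `Iota3.not_isTiePosition_map_of_baseChange`, DISCHARGED** for `φ : R → R'` formally smooth and essentially of
finite type between Noetherian rings. [cite: Wlodarczyk2022, App. Def. 5.1.1] -/
theorem exists_baseChange (x y : R') (t s : R) (q r : ℕ)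
    (hfil : ∀ n, weightedMonomialIdeal ![y, x] ![r, q] n = (weightedMonomialIdeal ![t, s] ![r, q] n).map (algebraMap R R')) :
    ∃ ψ : extReesAlgebra (weightedMonomialIdeal ![t, s] ![r, q]) →+* extReesAlgebra (weightedMonomialIdeal ![y, x] ![r, q]),
      (∀ a : R, ψ (algebraMap R _ a) = algebraMap R' _ (algebraMap R R' a)) ∧
      ψ (extReesAlgebra.tInv _) = extReesAlgebra.tInv _ ∧
      extReesAlgebra.vertexIdeal (weightedMonomialIdeal ![y, x] ![r, q]) ≤
        (extReesAlgebra.vertexIdeal (weightedMonomialIdeal ![t, s] ![r, q])).map ψ ∧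
      ∀ (𝔫 : Ideal (extReesAlgebra (weightedMonomialIdeal ![y, x] ![r, q]))) [𝔫.IsPrime]
        (b : extReesAlgebra (weightedMonomialIdeal ![t, s] ![r, q])),
        adicOrder (algebraMap _ (Localization.AtPrime 𝔫) (ψ b)) ≤
          adicOrder (algebraMap _ (Localization.AtPrime (𝔫.comap ψ)) b) := by
  have hle : ∀ n, (weightedMonomialIdeal ![t, s] ![r, q] n).map (algebraMap R R') ≤ weightedMonomialIdeal ![y, x] ![r, q] n :=
    fun n => (hfil n).ge
  obtain ⟨ψ, hψ, hψa, hψt, hψV⟩ := exists_map (algebraMap R R') (weightedMonomialIdeal ![t, s] ![r, q])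
    (weightedMonomialIdeal ![y, x] ![r, q]) hle
  refine ⟨ψ, hψa, hψt, hψV fun n _ => hfil n, fun 𝔫 _ b => ?_⟩
  exact (adicOrder_eq_of_formallySmooth R R' ![t, s] ![r, q] (weightedMonomialIdeal ![y, x] ![r, q]) hfil ψ hψ 𝔫 b).le

end Smooth

end ExtReesMap

/-! ## (desc-τ) case A′ in the door setting, unconditional -/

namespace Iota3

/-- **(desc-τ) CASE A′ — NO TIE POSITION OVER A TWO-DIMENSIONAL BASE — IN THE DOOR SETTING, UNCONDITIONALLY.**  `T` regular local of
dimension two, essentially of finite type over a field `k₀`; `φ : T → T'` local, formally smooth, essentially of finite type, `T'` regular local.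
Then `(T', φ g)` is not a tie position, for every `g ∈ T`.  (`Iota3.not_isTiePosition_map_of_baseChange` with its base-change hypothesis
discharged by `ExtReesMap.exists_baseChange`.) [OURS · (desc-τ) case A′, door setting] [cite: AbramovichQuekSchober2025, Thm 1.3 (3)] -/
theorem not_isTiePosition_map_of_ringKrullDim_eq_two (T T' : Type) [CommRing T] [CommRing T'] [IsRegularLocalRing T]
    [IsRegularLocalRing T'] [Algebra T T'] [IsLocalHom (algebraMap T T')] [Algebra.FormallySmooth T T'] [Algebra.EssFiniteType T T']
    (k₀ : Type) [Field k₀] [Algebra k₀ T] [Algebra.EssFiniteType k₀ T] (hdimT : ringKrullDim T = (2 : ℕ)) (g : T) :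
    ¬ IsTiePosition T' (algebraMap T T' g) := by
  haveI : Module.Flat T T' := IotaOrderEssSmooth.flat_of_formallySmooth_of_essFiniteType T T'
  exact not_isTiePosition_map_of_baseChange T T' k₀ hdimT fun x y t s q r hfil => ExtReesMap.exists_baseChange T T' x y t s q r hfil

end Iota3

end Summit.ResolutionOfSingularities.ResolutionOfSingularities.Cruxes.HypersurfaceCentreConstruction.LocalEngine

end
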